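import Summits.AnomalousDissipation.AnomalousDissipation.Theses.SteadyWeakLimit
import Summits.AnomalousDissipation.AnomalousDissipation.Theorems.SteadyWeakLimitInjectionWeaklyContinuous
import Summits.AnomalousDissipation.AnomalousDissipation.Theorems.SteadyWeakLimitSteadyToSummit

/-!
# Route SteadyWeakLimit — the assembly `Assembly`

Proof of the route declaration
`Summit.AnomalousDissipation.AnomalousDissipation.Theses.SteadyWeakLimit.Assembly`
(item stmt-AnomalousDissipation-1306): steady weak realisation `SteadyWeakRealisation` (Thesis X)
implies the summit statement `AnomalousDissipation = Literature.Turb.ZerothLaw`.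

Mathematics (Temam 1979, Ch. II (1.21)–(1.22); Constantin–Tarfulea–Vicol 2013, p. 6;
Doering–Foias 2002, §2): along the steady classical states `u j` of `NS_{ν j}(f)` given by X,
the dissipation `ν j ‖∇u j‖₂²` equals the injection `∫ ⟪f, u j⟫` and therefore converges to
`c := ∫ ⟪f, v⟫ > 0` by weak convergence — this is the landed support
`injectionWeaklyContinuous_proof` (item 1307) applied with the constant force sequence `fs j = f`.
Hence `c / 2 ≤ ν j ‖∇u j‖₂²` for all `j ≥ J`; re-indexing the family by `j ↦ j + J` produces the
antecedent of the landed support `steadyToSummit_proof` (item 1311; = CoherentStates' crux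
`SteadyZerothLaw`, item 0219, verbatim), which gives the summit. This is exactly the composition
`SteadyToSummit ∘ GlueSteadyZerothLaw` of the route header, with the glue step inlined.

Design: no new definitions and no new lemmas; imports the route file and the two landed supports.
Not here: anything about the existence of such steady families (the crux `SteadyWeakRealisation`).
-/

namespace Summit.AnomalousDissipation.AnomalousDissipation.Theorems

-- the mandated namespace `Summit.<Summit>.<Problem>.Theorems` repeats `AnomalousDissipation` (single-problem summit)
set_option linter.dupNamespace false

open MeasureTheory Filter Topology
open scoped InnerProductSpace
open Literature.Analysis.FunctionSpaces Literature.Analysis.FunctionSpaces.Torus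
open Summit.AnomalousDissipation.AnomalousDissipation.Theses.SteadyWeakLimit

/-- **Assembly of route SteadyWeakLimit** (item stmt-AnomalousDissipation-1306):
`SteadyWeakRealisation → AnomalousDissipation`. Given the data of X — a smooth divergence-free
mean-zero steady force `f`, viscosities `ν j → 0⁺`, steady classical states `(u j, p j)` of
`NS_{ν j}(f)` with `∫ ‖u j‖² ≤ E`, converging weakly (against smooth fields) to `v` with
`c := ∫ ⟪f, v⟫ > 0` — the dissipation `ν j * gradNormSq (u j)` tends to `c`
(`injectionWeaklyContinuous_proof` with `fs j = f`), so it is `≥ c / 2` from some rank `J` on; the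
family re-indexed by `j ↦ j + J` satisfies the steady zeroth law, and `steadyToSummit_proof`
concludes. [folklore] -/
theorem steadyWeakLimitAssembly_proof :
    Summit.AnomalousDissipation.AnomalousDissipation.Theses.SteadyWeakLimit.Assembly := by
  unfold Assembly
  rintro ⟨f, hf, hdiv, hmean, ν, u, p, v, hν, hν0, hsol, ⟨E, hE⟩, -, hweak, hpos⟩
  -- the constant force sequence `fs j = f` converges to `f` in `L²`
  have hconv : Tendsto (fun j : ℕ => eLpNorm ((fun _ : ℕ => f) j - f) 2 volume) atTop (𝓝 0) := by
    simp only [sub_self, eLpNorm_zero]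
    exact tendsto_const_nhds
  -- dissipation converges to the injection (support `InjectionWeaklyContinuous`, item 1307)
  have hdiss : Tendsto (fun j => ν j * gradNormSq (u j)) atTop (𝓝 (∫ x, ⟪f x, v x⟫_ℝ)) :=
    injectionWeaklyContinuous_proof f v ν (fun _ => f) u p E hf (fun _ => hf) hconv hsol hE hweak
  -- from some rank on the dissipation is at least half the (positive) injection
  obtain ⟨J, hJ⟩ := eventually_atTop.1 (hdiss.eventually_const_le (half_lt_self hpos))
  -- re-index by `j ↦ j + J` and apply the support `SteadyToSummit` (item 1311)
  exact steadyToSummit_proof ⟨f, hf, hdiv, hmean, fun j => ν (j + J), fun j => u (j + J),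
    fun j => p (j + J), fun j => hν (j + J), hν0.comp (tendsto_add_atTop_nat J),
    fun j => hsol (j + J), ⟨E, fun j => hE (j + J)⟩, (∫ x, ⟪f x, v x⟫_ℝ) / 2, half_pos hpos,
    fun j => hJ (j + J) (Nat.le_add_left J j)⟩

end Summit.AnomalousDissipation.AnomalousDissipation.Theorems
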